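import Summits.ResolutionOfSingularities.ResolutionOfSingularities.Theorems.MarkedTransferCampaignW46MohWindowShadeCycle
import HarnessLib

/-!
# [OURS · L1 W4.6] Rung (iii) "Moh window" for the classical pair — NO strictly decreasing invariant exists
  for arbitrary equimultiple point blow-ups inside the window (every characteristic)

Cell `res-hironaka`, rung L, slot W4.6, seat `res-L1-s46-pv-6` (gen 2).  The formal content of the lane-B
reading note on desk #35 («NoKangaroo … is the NO-INCREASE half of the Eq. (127) role») for ARBITRARY point
centres: in the classical model (`PointBlowup.State/step`, [Hauser2010, §§F–G]) there is NO function of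
the state, with values in any preorder, that strictly decreases at every equimultiple point blow-up of
every cleaned in-window state with `y^r ∣ F` — because of the two-cycle of
`MarkedTransferCampaignW46MohWindowShadeCycle.lean` (`(F_1, r) ↦ (F_{−1}, r) ↦ (F_1, r)`, order `p + 1`,
shade `p`, surfaces, every `p`).  So a "decrease half" of the Eq. (127) role for the classical model needs
either a restriction of the states (gen 2's terminal case and bottom edge, where `|r|` resp. nothing-to-do
decreases) or centres the coordinate-bound model does not have (the non-coordinate curve of the hidden
monomial case).  OURS; NOT a statement of the manuscript [claim: Hironaka2017, status: under-review],
nothing of which is used; not a claim about resolution of singularities.  AI review is weaker than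
expert review.
-/

noncomputable section

set_option linter.dupNamespace false -- mandated namespace of this single-conjunct summit

namespace Summit.ResolutionOfSingularities.ResolutionOfSingularities.Theorems.CampaignW46.MohWindowShadeNoInvariant

open Literature.AlgebraicGeometry.Resolution
open Literature.AlgebraicGeometry.Resolution.PointBlowup
open Literature.AlgebraicGeometry.Resolution.Hauser2010

/-- **[OURS · L1 W4.6] No strictly decreasing invariant for in-window equimultiple point blow-ups
(surfaces, every characteristic).**  For every prime `p`, every field `K` of characteristic `p` and every
preorder `β`, there is no `Φ : State (Fin 2) K → β` with `Φ (step p j b s) < Φ s` at every equimultiple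
point `b` (`b_j = 0`) of every chart `y_j` of every CLEANED state `s` with `y^r ∣ F` inside the window
`p ≤ ord₀ F < 2p`.  (Apply `Φ` around the two-cycle of `MohWindowShadeCycle.exists_two_cycle_in_window`.)
NOT a statement of the manuscript. [folklore] -/
theorem no_strictly_decreasing_invariant (p : ℕ) [Fact p.Prime] (K : Type*) [Field K] [CharP K p]
    [DecidableEq K] (β : Type*) [Preorder β] :
    ¬ ∃ Φ : State (Fin 2) K → β, ∀ (s : State (Fin 2) K) (j : Fin 2) (b : Fin 2 → K), b j = 0 →
      deletePthPowers p s.F = s.F → (∀ d ∈ s.F.support, s.r ≤ d) → (p : ℕ∞) ≤ ordZero s.F →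
      ordZero s.F < (2 * p : ℕ) → IsEquimultiplePoint p j b s → Φ (step p j b s) < Φ s := by
  rintro ⟨Φ, hΦ⟩
  obtain ⟨s₁, s₂, j, b₁, b₂, hb₁, hb₂, hc₁, hc₂, hr₁, hr₂, ho₁, ho₂, -, -, he₁, hst₁, he₂, hst₂⟩ :=
    MohWindowShadeCycle.exists_two_cycle_in_window p K
  have hp1 : 1 < p := (Fact.out : p.Prime).one_lt
  have hlo : ∀ {s : State (Fin 2) K}, ordZero s.F = (p + 1 : ℕ) → (p : ℕ∞) ≤ ordZero s.F :=
    fun h => by rw [h]; exact_mod_cast (by omega : p ≤ p + 1)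
  have hhi : ∀ {s : State (Fin 2) K}, ordZero s.F = (p + 1 : ℕ) → ordZero s.F < (2 * p : ℕ) :=
    fun h => by rw [h]; exact_mod_cast (by omega : p + 1 < 2 * p)
  have h1 := hΦ s₁ j b₁ hb₁ hc₁ hr₁ (hlo ho₁) (hhi ho₁) he₁
  have h2 := hΦ s₂ j b₂ hb₂ hc₂ hr₂ (hlo ho₂) (hhi ho₂) he₂
  rw [hst₁] at h1
  rw [hst₂] at h2
  exact lt_asymm h1 h2

/-- **[OURS · L1 W4.6] In particular no such `ℕ`-valued invariant** (the shape of a termination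
argument by a well-founded measure, cf. `MarkedTransferCampaignW46PermissibleReduction.lean`'s
"termination by a well-founded measure" for the typed procedure).  NOT a statement of the manuscript.
[folklore] -/
theorem no_nat_measure (p : ℕ) [Fact p.Prime] (K : Type*) [Field K] [CharP K p] [DecidableEq K] :
    ¬ ∃ Φ : State (Fin 2) K → ℕ, ∀ (s : State (Fin 2) K) (j : Fin 2) (b : Fin 2 → K), b j = 0 →
      deletePthPowers p s.F = s.F → (∀ d ∈ s.F.support, s.r ≤ d) → (p : ℕ∞) ≤ ordZero s.F →
      ordZero s.F < (2 * p : ℕ) → IsEquimultiplePoint p j b s → Φ (step p j b s) < Φ s :=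
  no_strictly_decreasing_invariant p K ℕ

end Summit.ResolutionOfSingularities.ResolutionOfSingularities.Theorems.CampaignW46.MohWindowShadeNoInvariant
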